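import Summits.HubbardSuperconductivity.HubbardSuperconductivity.Theses.AposterioriCapRg
import Literature.MathematicalPhysics.QuantumLattice.HubbardGrandCanonicalParticleHole

/-!
# Crux `CapRgSymmetricCertificatePinned` (item `stmt-HubbardSuperconductivity-14045`, route
# `AposterioriCapRg`): every witness `(U, δ, μ)` has `μ < U/2` — the density clause pins the operator
# chemical potential strictly below the particle–hole mirror point

Negative-side support lemmas (lead c8, 2026-08-17), companions of `SymmetricTadpole.lean` (lead c7) for the
FRAME finding M1 of refuter rattack-14045 / leads c6–c7 (`Cruxes/CapRgSymmetricCertificatePinned/VERDICT-c6.md`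
§1).  Conjunct 1 of the crux is the density clause of the OPERATOR model,
`n_{L+1}(U, μ) := Re ω₀[hubbardTorusWith 2 (L+1) 1 U μ](N)/(L+1)² → 1 - δ` with `δ ≥ 1/5 > 0`.  By the
grand-canonical particle–hole mirror on even tori (`Literature/…/HubbardGrandCanonicalParticleHole.lean`,
Lieb 1989: `n_L(U, μ) + n_L(U, U - μ) = 2` and `n_L(U, U/2) = 1` at every even side `L`, hence
`1 ≤ n_{L+1}(U, μ)` frequently in `L` whenever `U/2 ≤ μ`), a limiting density `< 1` forces `μ < U/2`:

* `mu_lt_half_coupling_of_tendsto_gcDensity` — `n_{L+1}(U, μ) → ρ < 1 ⇒ μ < U/2`;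
  `not_densityClause_half_coupling` — `μ = U/2` is never a witness of a density clause with `δ ≠ 0`;
* `capRgSymmetricCertificatePinned_iff_below_half` — the crux is EQUIVALENT to its restriction to
  `μ < U/2`: any proof may assume, and any refutation must handle, only operator chemical potentials strictly
  below the mirror point `U/2` (half filling); likewise `fixedPointDWaveOrder_iff_below_half` for the route's
  target `FixedPointDWaveOrder`;
* `seededBrokenRegime_hypothesis_mu_lt_half` — the consumer `SeededBrokenRegimeBoseFermiPinned`'s density
  hypothesis is only ever instantiated at `μ < U/2`.

Read together with M1 (the Grassmann object `hubbardEffectiveActionCT L M β U μ 0 K Λ` of conjunct 2 sits at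
OPERATOR chemical potential `μ + U/2`, `SymmetricTadpole.lean` + `hubbardTorusWith_add_half_mul_coupling`):
as filed, conjunct 2 certifies the countertermed action at a Grassmann chemical potential `μ < U/2` read in
the symmetrised convention, i.e. the operator model at `μ + U/2 ∈ (μ, U)`, never the operator model at the
`μ` of conjunct 1.  Nothing here asserts or refutes a Theses decl. [folklore]
-/

noncomputable section

namespace Summit.HubbardSuperconductivity.CapRgSymmetricCertificatePinned.Negative

open Filter Topology
open Literature.MathematicalPhysics.QuantumLattice Literature.Probability.LatticeModels Matrix
open Summit.HubbardSuperconductivity.HubbardSuperconductivity.Theses.AposterioriCapRg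

/-- **A limiting density below one forces `μ < U/2`** (operator convention `U Σ n↑n↓ - μN`, hopping `t`):
if `n_{L+1}(t, U, μ) → ρ` along all sides and `ρ < 1`, then `μ < U/2` — at `μ ≥ U/2` the even sides carry
density `≥ 1` (`one_le_of_tendsto_gcDensity`). [folklore] -/
theorem mu_lt_half_coupling_of_tendsto_gcDensity (t U : ℝ) {μ ρ : ℝ} (hρ : ρ < 1)
    (h : Tendsto (fun L : ℕ => ((hubbardTorusWith 2 (L + 1) t U μ).groundStateFunctional totalNumber).re /
      ((L + 1 : ℕ) : ℝ) ^ 2) atTop (𝓝 ρ)) : μ < U / 2 := by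
  by_contra hμ
  have h1 := one_le_of_tendsto_gcDensity t U (not_lt.1 hμ) h
  linarith

/-- **A limiting density above one forces `U/2 < μ`.** [folklore] -/
theorem half_coupling_lt_mu_of_tendsto_gcDensity (t U : ℝ) {μ ρ : ℝ} (hρ : 1 < ρ)
    (h : Tendsto (fun L : ℕ => ((hubbardTorusWith 2 (L + 1) t U μ).groundStateFunctional totalNumber).re /
      ((L + 1 : ℕ) : ℝ) ^ 2) atTop (𝓝 ρ)) : U / 2 < μ := by
  by_contra hμ
  have h1 := le_one_of_tendsto_gcDensity t U (not_lt.1 hμ) h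
  linarith

/-- **The mirror point is never a witness**: no density clause `n_{L+1}(t, U, U/2) → 1 - δ` with `δ ≠ 0`
holds (the limit at `μ = U/2`, if it exists, is `1`). [folklore] -/
theorem not_densityClause_half_coupling (t U : ℝ) {δ : ℝ} (hδ : δ ≠ 0) :
    ¬ Tendsto (fun L : ℕ => ((hubbardTorusWith 2 (L + 1) t U (U / 2)).groundStateFunctional
      totalNumber).re / ((L + 1 : ℕ) : ℝ) ^ 2) atTop (𝓝 (1 - δ)) := fun h =>
  hδ (by linarith [eq_one_of_tendsto_gcDensity_half_coupling t U h])

/-- **The crux is equivalent to its restriction to `μ < U/2`.**  Every witness `(U, δ, μ)` of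
`CapRgSymmetricCertificatePinned` has its OPERATOR chemical potential strictly below the particle–hole mirror
point: `δ ≥ 1/5` makes the limiting density `1 - δ < 1`. [folklore] -/
theorem capRgSymmetricCertificatePinned_iff_below_half :
    CapRgSymmetricCertificatePinned ↔
      ∃ U ∈ Set.Icc (2:ℝ) 3, ∃ δ ∈ Set.Icc (1/5:ℝ) (7/20), ∃ μ : ℝ, μ < U / 2 ∧
        Tendsto (fun L : ℕ => ((hubbardTorusWith 2 (L + 1) 1 U μ).groundStateFunctional
          totalNumber).re / ((L + 1 : ℕ) : ℝ) ^ 2) atTop (𝓝 (1 - δ)) ∧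
        ∀ Θ : SymmetricTolerance, ∃ (K : TrigPolyC4v) (Λ : ℝ) (L₀ : ℕ),
          symmetricRegimeCertificateT U μ capRgCornerDataT Θ K Λ L₀ := by
  constructor
  · rintro ⟨U, hU, δ, hδ, μ, hdens, hcert⟩
    exact ⟨U, hU, δ, hδ, μ,
      mu_lt_half_coupling_of_tendsto_gcDensity 1 U (by linarith [hδ.1]) hdens, hdens, hcert⟩
  · rintro ⟨U, hU, δ, hδ, μ, -, hdens, hcert⟩
    exact ⟨U, hU, δ, hδ, μ, hdens, hcert⟩

/-- **The route's target restricted to `μ < U/2`**: `FixedPointDWaveOrder` is equivalent to the same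
statement with the operator chemical potential strictly below the mirror point. [folklore] -/
theorem fixedPointDWaveOrder_iff_below_half :
    FixedPointDWaveOrder ↔
      ∃ U ∈ Set.Icc (2:ℝ) 3, ∃ δ ∈ Set.Icc (1/5:ℝ) (7/20), ∃ μ : ℝ, μ < U / 2 ∧
        Tendsto (fun L : ℕ => ((hubbardTorusWith 2 (L + 1) 1 U μ).groundStateFunctional
          totalNumber).re / ((L + 1 : ℕ) : ℝ) ^ 2) atTop (𝓝 (1 - δ)) ∧ HasDWaveOrder U μ := by
  constructor
  · rintro ⟨U, hU, δ, hδ, μ, hdens, hord⟩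
    exact ⟨U, hU, δ, hδ, μ,
      mu_lt_half_coupling_of_tendsto_gcDensity 1 U (by linarith [hδ.1]) hdens, hdens, hord⟩
  · rintro ⟨U, hU, δ, hδ, μ, -, hdens, hord⟩
    exact ⟨U, hU, δ, hδ, μ, hdens, hord⟩

/-- **The consumer's hypothesis lives below the mirror point**: in the box of
`SeededBrokenRegimeBoseFermiPinned` (`U ∈ [2,3]`, `δ ∈ [1/5, 7/20]`), the density hypothesis
`n_{L+1}(U, μ) → 1 - δ` can only hold at `μ < U/2`. [folklore] -/
theorem seededBrokenRegime_hypothesis_mu_lt_half {U δ μ : ℝ} (hδ : δ ∈ Set.Icc (1/5:ℝ) (7/20))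
    (hdens : Tendsto (fun L : ℕ => ((hubbardTorusWith 2 (L + 1) 1 U μ).groundStateFunctional
      totalNumber).re / ((L + 1 : ℕ) : ℝ) ^ 2) atTop (𝓝 (1 - δ))) : μ < U / 2 :=
  mu_lt_half_coupling_of_tendsto_gcDensity 1 U (by linarith [hδ.1]) hdens

end Summit.HubbardSuperconductivity.CapRgSymmetricCertificatePinned.Negative

end
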